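import Summits.RiemannHypothesis.RiemannHypothesis.Theorems.SoloInformedCellCount
import HarnessLib

/-!
# Pair-correlation rigidity, step R4': occupied cells from a second moment, counting-function
form (T72c', soloist)

Sorry-free; pure measure theory.  The counting-function version of `SoloInformedCellCount`:
`N : ℝ → ℝ` monotone (think `N = zetaZeroCount`), a window `[A, A + J/b)` cut into `J` cells
`C_j = [A + j/b, A + (j+1)/b)` with increments `n_j = N(A + (j+1)/b) - N(A + j/b) ≥ 0`, and a
function `Z` with `Z(t) ≥ b μ n_j` on `C_j` and `∫ Z² ≤ M` over the window.  Then the number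
of cells on which `N` jumps satisfies

  `#{j < J : N(A + j/b) < N(A + (j+1)/b)} · M ≥ b μ² (N(A + J/b) - N(A))²`

(`mul_sq_increment_le_card_mul_integral_sq`).  With `Z(t) = Re Q(f_{b,t})` (the rigidity probe,
`SoloInformedRigidityProbe.probe_zetaZeroCount_le_re_weilQuadratic` supplies the cell
hypothesis under RH) this is step (C) of Lemma 2k.E in the soloist's `paper/sharpest.md`
§2k (xi): many zeros + bounded second moment ⟹ many occupied `1/b`-cells ⟹ many ordinates
pairwise `≥ 1/b` apart.
-/

noncomputable section

open Set MeasureTheory Finset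
open scoped Real

namespace Summit.RiemannHypothesis.RiemannHypothesis.Theorems

/-- **Occupied cells from a second moment, counting-function form.** -/
theorem mul_sq_increment_le_card_mul_integral_sq (N : ℝ → ℝ) (hN : Monotone N) {b μ : ℝ}
    (hb : 0 < b) (hμ : 0 ≤ μ) (A : ℝ) (J : ℕ) (Z : ℝ → ℝ)
    (hZ : ∀ j < J, ∀ t ∈ Ico (A + (j : ℝ) / b) (A + ((j : ℝ) + 1) / b),
      b * μ * (N (A + ((j : ℝ) + 1) / b) - N (A + (j : ℝ) / b)) ≤ Z t)
    (hint : IntegrableOn (fun t ↦ Z t ^ 2) (Ico A (A + J / b))) :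
    b * μ ^ 2 * (N (A + J / b) - N A) ^ 2 ≤
      ((range J).filter (fun j : ℕ ↦ N (A + (j : ℝ) / b) < N (A + ((j : ℝ) + 1) / b))).card *
        ∫ t in Ico A (A + J / b), Z t ^ 2 := by
  classical
  obtain ⟨C, hC⟩ : ∃ C : ℕ → Set ℝ, C = fun j : ℕ ↦ Ico (A + (j : ℝ) / b) (A + ((j : ℝ) + 1) / b) :=
    ⟨_, rfl⟩
  obtain ⟨n, hn⟩ : ∃ n : ℕ → ℝ, n = fun j : ℕ ↦ N (A + ((j : ℝ) + 1) / b) - N (A + (j : ℝ) / b) :=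
    ⟨_, rfl⟩
  have hstep : ∀ j : ℕ, A + (j : ℝ) / b ≤ A + ((j : ℝ) + 1) / b := fun j ↦ by
    have : (j : ℝ) / b ≤ ((j : ℝ) + 1) / b := div_le_div_of_nonneg_right (by linarith) hb.le
    linarith
  have hn0 : ∀ j, 0 ≤ n j := fun j ↦ by rw [hn]; exact sub_nonneg.2 (hN (hstep j))
  have hCW : ∀ j < J, C j ⊆ Ico A (A + J / b) := by
    intro j hj t ht
    rw [hC] at ht
    obtain ⟨h1, h2⟩ := ht
    have hj' : (j : ℝ) + 1 ≤ J := by exact_mod_cast hj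
    have hjb : (0 : ℝ) ≤ j / b := by positivity
    have hJb : ((j : ℝ) + 1) / b ≤ J / b := div_le_div_of_nonneg_right hj' hb.le
    exact ⟨by linarith, by linarith⟩
  -- Step 1: on the cell `C j`, `Z ≥ b μ n j`
  have hcell : ∀ j < J, ∀ t ∈ C j, b * μ * n j ≤ Z t := by
    intro j hj t ht
    rw [hC] at ht
    rw [hn]
    exact hZ j hj t ht
  -- Step 2: the integral over one cell
  have hmeasC : ∀ j, MeasurableSet (C j) := fun j ↦ by rw [hC]; exact measurableSet_Ico
  have hvolC : ∀ j : ℕ, volume.real (C j) = 1 / b := by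
    intro j
    rw [hC]
    simp only [Real.volume_real_Ico]
    rw [show A + ((j : ℝ) + 1) / b - (A + j / b) = 1 / b by ring,
      max_eq_left (by positivity)]
  have hintC : ∀ j < J, IntegrableOn (fun t ↦ Z t ^ 2) (C j) :=
    fun j hj ↦ hint.mono_set (hCW j hj)
  have hcellInt : ∀ j < J, b * μ ^ 2 * n j ^ 2 ≤ ∫ t in C j, Z t ^ 2 := by
    intro j hj
    have hconst : ∫ _ in C j, (b * μ * n j) ^ 2 = 1 / b * (b * μ * n j) ^ 2 := by
      rw [setIntegral_const, hvolC, smul_eq_mul]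
    have hconstInt : IntegrableOn (fun _ : ℝ ↦ (b * μ * n j) ^ 2) (C j) := by
      rw [hC]
      exact continuous_const.integrableOn_Icc.mono_set Ico_subset_Icc_self
    calc b * μ ^ 2 * n j ^ 2 = 1 / b * (b * μ * n j) ^ 2 := by
          rw [div_mul_eq_mul_div, one_mul, eq_div_iff hb.ne']; ring
      _ = ∫ _ in C j, (b * μ * n j) ^ 2 := hconst.symm
      _ ≤ ∫ t in C j, Z t ^ 2 :=
          setIntegral_mono_on hconstInt (hintC j hj) (hmeasC j) fun t ht ↦
            pow_le_pow_left₀ (mul_nonneg (by positivity) (hn0 j)) (hcell j hj t ht) 2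
  -- Step 3: the cells are disjoint pieces of the window
  have hdisj : Set.Pairwise (↑(range J) : Set ℕ) (Function.onFun Disjoint C) := by
    intro i _ j _ hij
    simp only [Function.onFun]
    rw [hC]
    rcases lt_or_gt_of_ne hij with h | h
    · exact cell_disjoint hb h
    · exact (cell_disjoint hb h).symm
  have hU : (⋃ j ∈ range J, C j) ⊆ Ico A (A + J / b) :=
    Set.iUnion₂_subset fun j hj ↦ hCW j (mem_range.1 hj)
  have hsumInt : ∑ j ∈ range J, ∫ t in C j, Z t ^ 2 ≤ ∫ t in Ico A (A + J / b), Z t ^ 2 := by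
    rw [← integral_biUnion_finset (range J) (fun j _ ↦ hmeasC j) hdisj
      (fun j hj ↦ hintC j (mem_range.1 hj))]
    exact setIntegral_mono_set hint (ae_of_all _ fun t ↦ sq_nonneg (Z t)) hU.eventuallyLE
  -- Step 4: the increments telescope
  have htel : ∑ j ∈ range J, n j = N (A + J / b) - N A := by
    have h := Finset.sum_range_sub (fun j : ℕ ↦ N (A + (j : ℝ) / b)) J
    simp only [Nat.cast_succ, Nat.cast_zero, zero_div, add_zero] at h
    rw [hn]
    exact h
  -- Step 5: silent cells carry no increment; Cauchy–Schwarz over the jumping ones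
  obtain ⟨F, hF⟩ : ∃ F : Finset ℕ,
      F = (range J).filter (fun j : ℕ ↦ N (A + (j : ℝ) / b) < N (A + ((j : ℝ) + 1) / b)) :=
    ⟨_, rfl⟩
  rw [← hF]
  have hFsub : F ⊆ range J := by rw [hF]; exact filter_subset _ _
  have hzero : ∀ j ∈ range J, ¬ N (A + (j : ℝ) / b) < N (A + ((j : ℝ) + 1) / b) → n j = 0 := by
    intro j _ hj
    rw [hn]
    have := hN (hstep j)
    push Not at hj
    linarith
  have hsumF : ∑ j ∈ range J, n j = ∑ j ∈ F, n j := by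
    rw [hF, sum_filter]
    refine sum_congr rfl fun j hj ↦ ?_
    split_ifs with h
    · rfl
    · exact hzero j hj h
  have hCS : (∑ j ∈ F, n j) ^ 2 ≤ F.card * ∑ j ∈ F, n j ^ 2 := by
    have hcs := sum_mul_sq_le_sq_mul_sq F n (fun _ ↦ (1 : ℝ))
    simp only [mul_one, one_pow, sum_const, nsmul_eq_mul] at hcs
    linarith
  have hFJ : ∑ j ∈ F, n j ^ 2 ≤ ∑ j ∈ range J, n j ^ 2 :=
    sum_le_sum_of_subset_of_nonneg hFsub fun j _ _ ↦ sq_nonneg (n j)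
  have hI0 : 0 ≤ ∫ t in Ico A (A + J / b), Z t ^ 2 := setIntegral_nonneg measurableSet_Ico
    fun t _ ↦ sq_nonneg (Z t)
  have hS0 : 0 ≤ ∑ j ∈ range J, n j ^ 2 := sum_nonneg fun j _ ↦ sq_nonneg (n j)
  calc b * μ ^ 2 * (N (A + J / b) - N A) ^ 2 = b * μ ^ 2 * (∑ j ∈ F, n j) ^ 2 := by
        rw [← htel, hsumF]
    _ ≤ b * μ ^ 2 * (F.card * ∑ j ∈ F, n j ^ 2) := by gcongr
    _ ≤ b * μ ^ 2 * (F.card * ∑ j ∈ range J, n j ^ 2) := by gcongr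
    _ = F.card * ∑ j ∈ range J, b * μ ^ 2 * n j ^ 2 := by
        simp only [Finset.mul_sum]
        exact sum_congr rfl fun j _ ↦ by ring
    _ ≤ F.card * ∑ j ∈ range J, ∫ t in C j, Z t ^ 2 := by
        gcongr with j hj
        exact hcellInt j (mem_range.1 hj)
    _ ≤ F.card * ∫ t in Ico A (A + J / b), Z t ^ 2 := by gcongr

end Summit.RiemannHypothesis.RiemannHypothesis.Theorems

end
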